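import Summits.FinalStateConjecture.FinalStateConjecture.Theorems.EIHFluxBalanceInertialRecessionAnsatzDecay

/-!
# Route EIHFluxBalance — `InertialRecession`, line `sublinear-is-free-clean-window-charges`:
# polynomial dependence of the painted-summand derivatives on the jets (slaving stub `stub_slaving`)

Helper file for the crux `stmt-FinalStateConjecture-10166`
(`Summit.FinalStateConjecture.FinalStateConjecture.Theses.EIHFluxBalance.InertialRecession`),
stub `stub_slaving`, fact "F3" (cross-hole decoupling). The tree's far-field estimate for one
painted Kerr–Schild summand, `exists_norm_iteratedFDeriv_ksPert_frame_le'`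
(`…InertialRecessionBoostedDecay`), bounds `‖Dᵐ[(g_{M,a}(Θ(y⁰)(y − c(y⁰))) − η)∘(Θ(y⁰) ⊗ Θ(y⁰))](x)‖`
by `|M| C(m, Γ)/d` when ALL jets `‖Θ⁽ᵏ⁾‖`, `‖c⁽ᵏ⁾‖` (`k ≤ m`) are `≤ Γ`, with a constant `C(m, Γ)`
whose dependence on `Γ` is not recorded. The slaving analysis needs the dependence, because the
jets of the painted moduli are not bounded a priori: this file proves the sharp **degree-`m` law**

* `exists_norm_iteratedFDeriv_ksPert_frame_le_pow` (no definitions are introduced) — if `‖Θ⁽ᵏ⁾(x⁰)‖ ≤ Γ₀ Γᵏ` and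
  `‖c⁽ᵏ⁾(x⁰)‖ ≤ Γ₀ Γᵏ` (`k ≤ m`, `Γ ≥ 1`) then `‖Dᵐ[…](x)‖ ≤ Γᵐ · |M| C(m, Γ₀ + 1)/d`,

by TIME RESCALING: the affine change of lab coordinates `L(ỹ) = x + A_{1/Γ}(ỹ − x)`,
`A_γ v = v + ((γ − 1) v⁰) e₀` (which fixes `x` and the spatial coordinates and slows lab time down by
the factor `Γ`) turns the field into a field of the same shape with moduli
`Θ̃(σ) = Θ(t₀ + (σ − t₀)/Γ)`, `ĉ(σ) = c(t₀ + (σ − t₀)/Γ) − ((1/Γ − 1)(σ − t₀)) e₀` whose jets are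
`≤ Γ₀ + 1`; and `Dᵐ(F̂ ∘ L⁻¹)(x) = DᵐF̂(x) ∘ (A_Γ)^{⊗m}` with `‖A_Γ‖ ≤ Γ`
(`ContinuousLinearEquiv.iteratedFDerivWithin_comp_right`, translation invariance of `iteratedFDeriv`).
Elementary calculus; no named facts.
-/

set_option linter.dupNamespace false
set_option maxSynthPendingDepth 3

noncomputable section

open scoped Topology ContDiff
open Filter Set Function Literature.Geometry.Lorentzian
  Summit.FinalStateConjecture.FinalStateConjecture.Theorems

namespace Summit.FinalStateConjecture.FinalStateConjecture.Theorems.SublinearIsFree.Slaving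

/-! ### Time-rescaling maps `A v = v + ((γ − 1) v⁰) e₀` -/

section TimeScale

variable {γ γ' : ℝ} {A A' : E4 →L[ℝ] E4}

/-- `(A v)⁰ = γ v⁰` for a time-rescaling map `A v = v + ((γ − 1) v⁰) e₀`. [folklore] -/
theorem timeScale_apply_zero (hA : ∀ v : E4, A v = v + ((γ - 1) * v 0) • E4.basisVector 0)
    (v : E4) : A v 0 = γ * v 0 := by
  rw [hA, PiLp.add_apply, PiLp.smul_apply]
  simp [E4.basisVector]
  ring

/-- Composition of time-rescaling maps multiplies the factors. [folklore] -/
theorem timeScale_comp_apply (hA : ∀ v : E4, A v = v + ((γ - 1) * v 0) • E4.basisVector 0)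
    (hA' : ∀ v : E4, A' v = v + ((γ' - 1) * v 0) • E4.basisVector 0) (v : E4) :
    A (A' v) = v + ((γ * γ' - 1) * v 0) • E4.basisVector 0 := by
  have h0 := timeScale_apply_zero hA' v
  rw [hA (A' v), h0, hA', add_assoc, ← add_smul]
  congr 1
  ring_nf

/-- `‖A‖ ≤ 1 + |γ − 1|` for a time-rescaling map. [folklore] -/
theorem norm_timeScale_le (hA : ∀ v : E4, A v = v + ((γ - 1) * v 0) • E4.basisVector 0) :
    ‖A‖ ≤ 1 + |γ - 1| := by
  refine ContinuousLinearMap.opNorm_le_bound _ (by positivity) fun v ↦ ?_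
  rw [hA]
  have h0 : |v 0| ≤ ‖v‖ := by
    have := EuclideanSpace.norm_eq v ▸ Real.sqrt_le_sqrt
      (Finset.single_le_sum (fun i _ ↦ sq_nonneg (‖v i‖)) (Finset.mem_univ (0 : Fin 4)))
    rw [Real.sqrt_sq (norm_nonneg _)] at this
    simpa using this
  have h1 : ‖E4.basisVector 0‖ = 1 := by
    rw [EuclideanSpace.norm_eq]
    simp [E4.basisVector]
  calc ‖v + ((γ - 1) * v 0) • E4.basisVector 0‖
      ≤ ‖v‖ + ‖((γ - 1) * v 0) • E4.basisVector 0‖ := norm_add_le _ _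
    _ = ‖v‖ + |γ - 1| * |v 0| := by rw [norm_smul, h1, mul_one, Real.norm_eq_abs, abs_mul]
    _ ≤ ‖v‖ + |γ - 1| * ‖v‖ := by gcongr
    _ = (1 + |γ - 1|) * ‖v‖ := by ring

/-- For `Γ ≥ 1`: `‖A_Γ‖ ≤ Γ`. [folklore] -/
theorem norm_timeScale_le_self {Γ : ℝ} (hA : ∀ v : E4, A v = v + ((Γ - 1) * v 0) • E4.basisVector 0)
    (hΓ : 1 ≤ Γ) : ‖A‖ ≤ Γ := by
  refine (norm_timeScale_le hA).trans ?_
  rw [abs_of_nonneg (by linarith)]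
  linarith

end TimeScale

/-! ### Rescaled moduli -/

/-- Jets of a time-rescaled path: `(f ∘ (γ· + b))⁽ᵏ⁾(σ) = γᵏ f⁽ᵏ⁾(γσ + b)`. [folklore] -/
theorem iteratedDeriv_comp_affine {F : Type*} [NormedAddCommGroup F] [NormedSpace ℝ F]
    {f : ℝ → F} {n k : ℕ} (hf : ContDiff ℝ n f) (hk : k ≤ n) (γ b σ : ℝ) :
    iteratedDeriv k (fun s ↦ f (γ * s + b)) σ = γ ^ k • iteratedDeriv k f (γ * σ + b) := by
  have hfb : ContDiff ℝ k (fun s ↦ f (s + b)) := (hf.of_le (by exact_mod_cast hk)).comp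
    (contDiff_id.add contDiff_const)
  have h1 := congrFun (iteratedDeriv_comp_const_smul (n := k) hfb γ) σ
  rw [show (fun s ↦ f (γ * s + b)) = fun x ↦ (fun s ↦ f (s + b)) (γ * x) from rfl, h1]
  congr 1
  exact congrFun (iteratedDeriv_comp_add_const (n := k) (f := f) (s := b)) (γ * σ)

-- operator-norm instance paths on form-valued multilinear maps are slow to unify
set_option synthInstance.maxHeartbeats 200000 in
set_option maxHeartbeats 800000 in
/-- **Degree-`m` law for the painted-summand derivatives.** For every order `m` and size
`Γ₀ ≥ 1` there is `C ≥ 0` such that for all `M, a`, all `Cᵐ` moduli `Θ : ℝ → (E4 →L E4)`,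
`c : ℝ → E4`, every scale `Γ ≥ 1` and every lab point `x` with
`‖Θ⁽ᵏ⁾(x⁰)‖ ≤ Γ₀ Γᵏ` (`k ≤ m`), `‖c⁽ᵏ⁾(x⁰)‖ ≤ Γ₀ Γᵏ` (`1 ≤ k ≤ m`), `max 1 (2|a|) ≤ d`,
`‖x − c(x⁰)‖ ≤ d ≤ |Θ(x⁰)(x − c(x⁰))|_{spatial}`:
`‖Dᵐ [y ↦ (g_{M,a}(Θ(y⁰)(y − c(y⁰))) − η)∘(Θ(y⁰) ⊗ Θ(y⁰))](x)‖ ≤ Γᵐ |M| C / d`.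
(Time rescaling `L(ỹ) = x + A_{1/Γ}(ỹ − x)` reduces to `exists_norm_iteratedFDeriv_ksPert_frame_le'`
with jets `≤ Γ₀ + 1`; then `Dᵐ(F̂ ∘ L⁻¹) = DᵐF̂ ∘ A_Γ^{⊗m}`, `‖A_Γ‖ ≤ Γ`.) Each lab-time derivative of
the frozen ansatz costs exactly one power of the jet scale. Kerr–Schild 1965, §3. [folklore] -/
theorem exists_norm_iteratedFDeriv_ksPert_frame_le_pow (m : ℕ) {Γ₀ : ℝ} (hΓ₀ : 1 ≤ Γ₀) :
    ∃ C : ℝ, 0 ≤ C ∧ ∀ (M a : ℝ) (Θ : ℝ → E4 →L[ℝ] E4) (c : ℝ → E4) (x : E4) (d Γ : ℝ),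
      1 ≤ Γ → ContDiff ℝ m Θ → ContDiff ℝ m c →
      (∀ k ≤ m, ‖iteratedDeriv k Θ (x 0)‖ ≤ Γ₀ * Γ ^ k) →
      (∀ k, 1 ≤ k → k ≤ m → ‖iteratedDeriv k c (x 0)‖ ≤ Γ₀ * Γ ^ k) →
      max 1 (2 * |a|) ≤ d → ‖x - c (x 0)‖ ≤ d → d ≤ E4.spatialNorm (Θ (x 0) (x - c (x 0))) →
      ‖iteratedFDeriv ℝ m (fun y ↦ (Kerr.bilin M a (Θ (y 0) (y - c (y 0))) -
        Minkowski.bilin).bilinearComp (Θ (y 0)) (Θ (y 0))) x‖ ≤ Γ ^ m * (|M| * C / d) := by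
  have hΓ₀1 : 1 ≤ Γ₀ + 1 := by linarith
  obtain ⟨C, hC0, hC⟩ := exists_norm_iteratedFDeriv_ksPert_frame_le' m hΓ₀1
  refine ⟨C, hC0, fun M a Θ c x d Γ hΓ hΘ hc hΘb hcb hd hxc hsp ↦ ?_⟩
  have hΓ0 : 0 < Γ := one_pos.trans_le hΓ
  set γ : ℝ := Γ⁻¹ with hγ
  have hγ0 : 0 < γ := inv_pos.2 hΓ0
  have hγ1 : γ ≤ 1 := inv_le_one_of_one_le₀ hΓ
  have hγΓ : γ * Γ = 1 := inv_mul_cancel₀ hΓ0.ne'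
  set t₀ : ℝ := x 0 with ht₀
  -- the rescaled moduli
  set Θ' : ℝ → E4 →L[ℝ] E4 := fun σ ↦ Θ (γ * σ + (t₀ - γ * t₀)) with hΘ'
  set c' : ℝ → E4 := fun σ ↦ c (γ * σ + (t₀ - γ * t₀)) - ((γ - 1) * (σ - t₀)) • E4.basisVector 0
    with hc'
  have haff : ContDiff ℝ m (fun σ : ℝ ↦ γ * σ + (t₀ - γ * t₀)) :=
    (contDiff_const.mul contDiff_id).add contDiff_const
  have hΘ'c : ContDiff ℝ m Θ' := hΘ.comp haff
  have hlin : ContDiff ℝ m (fun σ : ℝ ↦ ((γ - 1) * (σ - t₀)) • E4.basisVector 0) :=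
    (contDiff_const.mul (contDiff_id.sub contDiff_const)).smul contDiff_const
  have hc'c : ContDiff ℝ m c' := (hc.comp haff).sub hlin
  have hat₀ : γ * t₀ + (t₀ - γ * t₀) = t₀ := by ring
  -- jets of the rescaled moduli at `t₀`
  have hΘ'b : ∀ k ≤ m, ‖iteratedDeriv k Θ' t₀‖ ≤ Γ₀ + 1 := by
    intro k hk
    have h1 : iteratedDeriv k Θ' t₀ = γ ^ k • iteratedDeriv k Θ t₀ := by
      rw [hΘ', iteratedDeriv_comp_affine hΘ hk, hat₀]
    rw [h1, norm_smul, norm_pow, Real.norm_eq_abs, abs_of_pos hγ0]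
    calc γ ^ k * ‖iteratedDeriv k Θ t₀‖ ≤ γ ^ k * (Γ₀ * Γ ^ k) :=
          mul_le_mul_of_nonneg_left (hΘb k hk) (by positivity)
      _ = Γ₀ * (γ * Γ) ^ k := by rw [mul_pow]; ring
      _ ≤ Γ₀ + 1 := by rw [hγΓ, one_pow, mul_one]; linarith
  have hc'b : ∀ k, 1 ≤ k → k ≤ m → ‖iteratedDeriv k c' t₀‖ ≤ Γ₀ + 1 := by
    intro k hk1 hk
    have hkc : ContDiffAt ℝ k (fun σ ↦ c (γ * σ + (t₀ - γ * t₀))) t₀ :=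
      ((hc.comp haff).of_le (by exact_mod_cast hk)).contDiffAt
    have hkl : ContDiffAt ℝ k (fun σ : ℝ ↦ ((γ - 1) * (σ - t₀)) • E4.basisVector 0) t₀ :=
      (hlin.of_le (by exact_mod_cast hk)).contDiffAt
    have h1 : iteratedDeriv k c' t₀ = γ ^ k • iteratedDeriv k c t₀ -
        iteratedDeriv k (fun σ : ℝ ↦ ((γ - 1) * (σ - t₀)) • E4.basisVector 0) t₀ := by
      have hfun : c' = (fun σ ↦ c (γ * σ + (t₀ - γ * t₀))) -
          fun σ : ℝ ↦ ((γ - 1) * (σ - t₀)) • E4.basisVector 0 := rfl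
      rw [hfun, iteratedDeriv_sub hkc hkl, iteratedDeriv_comp_affine hc hk, hat₀]
    -- the affine correction has first derivative `(γ - 1) e₀` and no higher ones
    have h2 : ‖iteratedDeriv k (fun σ : ℝ ↦ ((γ - 1) * (σ - t₀)) • E4.basisVector 0) t₀‖ ≤ 1 := by
      have hlin' : (fun σ : ℝ ↦ ((γ - 1) * (σ - t₀)) • E4.basisVector 0) =
          fun σ ↦ σ • ((γ - 1) • E4.basisVector 0) + (-(γ - 1) * t₀) • E4.basisVector 0 := by
        funext σ
        rw [smul_smul, ← add_smul]
        congr 1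
        ring
      have hd1 : deriv (fun σ : ℝ ↦ ((γ - 1) * (σ - t₀)) • E4.basisVector 0) =
          fun _ ↦ (γ - 1) • E4.basisVector 0 := by
        rw [hlin']
        funext σ
        have hsm : deriv (fun σ : ℝ ↦ σ • ((γ - 1) • E4.basisVector 0)) σ = (γ - 1) • E4.basisVector 0 := by
          rw [deriv_smul_const differentiableAt_id]
          simp
        rw [deriv_add_const, hsm]
      obtain ⟨k', rfl⟩ := Nat.exists_eq_add_of_le hk1
      rw [show 1 + k' = k' + 1 by omega, iteratedDeriv_succ', hd1]
      have h1' : ‖E4.basisVector 0‖ = 1 := by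
        rw [EuclideanSpace.norm_eq]
        simp [E4.basisVector]
      rcases Nat.eq_zero_or_pos k' with rfl | hk'
      · rw [iteratedDeriv_zero, norm_smul, Real.norm_eq_abs, h1', mul_one, abs_le]
        constructor <;> linarith
      · rw [iteratedDeriv_const, if_neg hk'.ne', norm_zero]
        exact zero_le_one
    rw [h1]
    calc ‖γ ^ k • iteratedDeriv k c t₀ -
          iteratedDeriv k (fun σ : ℝ ↦ ((γ - 1) * (σ - t₀)) • E4.basisVector 0) t₀‖
        ≤ ‖γ ^ k • iteratedDeriv k c t₀‖ +
          ‖iteratedDeriv k (fun σ : ℝ ↦ ((γ - 1) * (σ - t₀)) • E4.basisVector 0) t₀‖ :=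
          norm_sub_le _ _
      _ ≤ Γ₀ + 1 := by
          rw [norm_smul, norm_pow, Real.norm_eq_abs, abs_of_pos hγ0]
          have : γ ^ k * ‖iteratedDeriv k c t₀‖ ≤ Γ₀ := by
            calc γ ^ k * ‖iteratedDeriv k c t₀‖ ≤ γ ^ k * (Γ₀ * Γ ^ k) :=
                  mul_le_mul_of_nonneg_left (hcb k hk1 hk) (by positivity)
              _ = Γ₀ * (γ * Γ) ^ k := by rw [mul_pow]; ring
              _ = Γ₀ := by rw [hγΓ, one_pow, mul_one]
          linarith
  -- the rescaled field at `x`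
  have hc't₀ : c' t₀ = c t₀ := by
    rw [hc']
    simp only [hat₀, sub_self, mul_zero, zero_smul, sub_zero]
  have hΘ't₀ : Θ' t₀ = Θ t₀ := by rw [hΘ']; simp only [hat₀]
  have hx0 : x 0 = t₀ := rfl
  have hxc' : ‖x - c' (x 0)‖ ≤ d := by rw [hx0, hc't₀]; exact hxc
  have hsp' : d ≤ E4.spatialNorm (Θ' (x 0) (x - c' (x 0))) := by rw [hx0, hc't₀, hΘ't₀]; exact hsp
  have hΘ'b' : ∀ k ≤ m, ‖iteratedDeriv k Θ' (x 0)‖ ≤ Γ₀ + 1 := hΘ'b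
  have hc'b' : ∀ k, 1 ≤ k → k ≤ m → ‖iteratedDeriv k c' (x 0)‖ ≤ Γ₀ + 1 := hc'b
  have key := hC M a Θ' c' x d hΘ'c hc'c hΘ'b' hc'b' hd hxc' hsp'
  -- undo the rescaling: `F = F̂ ∘ L⁻¹`, `L⁻¹ y = A_Γ (y) + b`
  set F : E4 → E4 →L[ℝ] E4 →L[ℝ] ℝ := fun y ↦ (Kerr.bilin M a (Θ (y 0) (y - c (y 0))) -
    Minkowski.bilin).bilinearComp (Θ (y 0)) (Θ (y 0)) with hF
  set F' : E4 → E4 →L[ℝ] E4 →L[ℝ] ℝ := fun y ↦ (Kerr.bilin M a (Θ' (y 0) (y - c' (y 0))) -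
    Minkowski.bilin).bilinearComp (Θ' (y 0)) (Θ' (y 0)) with hF'
  -- the rescaling maps `A_Γ` (lab time sped up) and its inverse `A_γ`
  set T : ℝ → E4 →L[ℝ] E4 := fun μ ↦ ContinuousLinearMap.id ℝ E4 +
    (μ - 1) • (ContinuousLinearMap.smulRight (EuclideanSpace.proj (0 : Fin 4)) (E4.basisVector 0))
    with hT
  have hTapply : ∀ (μ : ℝ) (v : E4), T μ v = v + ((μ - 1) * v 0) • E4.basisVector 0 := by
    intro μ v
    simp [hT, mul_smul]
  have hTone : ∀ v : E4, v + (((1 : ℝ) - 1) * v 0) • E4.basisVector 0 = v := fun v ↦ by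
    rw [sub_self, zero_mul, zero_smul, add_zero]
  set AΓ : E4 ≃L[ℝ] E4 := ContinuousLinearEquiv.equivOfInverse (T Γ) (T γ)
    (fun v ↦ by rw [timeScale_comp_apply (hTapply γ) (hTapply Γ), hγ, inv_mul_cancel₀ hΓ0.ne', hTone])
    (fun v ↦ by rw [timeScale_comp_apply (hTapply Γ) (hTapply γ), hγ, mul_inv_cancel₀ hΓ0.ne', hTone])
    with hAΓ
  have hAΓapply : ∀ v : E4, AΓ v = T Γ v := fun v ↦ rfl
  have hAΓcoe : (AΓ : E4 →L[ℝ] E4) = T Γ := rfl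
  set b : E4 := x - T Γ x with hb
  have hAΓ0 : ∀ y : E4, (T Γ y + b) 0 = Γ * (y 0) + (t₀ - Γ * t₀) := by
    intro y
    rw [hb, PiLp.add_apply, PiLp.sub_apply, timeScale_apply_zero (hTapply Γ),
      timeScale_apply_zero (hTapply Γ), hx0]
  have htime : ∀ y : E4, γ * ((T Γ y + b) 0) + (t₀ - γ * t₀) = y 0 := by
    intro y
    rw [hAΓ0]
    have : γ * (Γ * y 0 + (t₀ - Γ * t₀)) + (t₀ - γ * t₀) = (γ * Γ) * y 0 + t₀ - (γ * Γ) * t₀ := by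
      ring
    rw [this, hγΓ]
    ring
  have hcomp : F = F' ∘ fun y ↦ T Γ y + b := by
    funext y
    simp only [Function.comp_apply, hF, hF']
    have h1 : Θ' ((T Γ y + b) 0) = Θ (y 0) := by
      show Θ (γ * ((T Γ y + b) 0) + (t₀ - γ * t₀)) = Θ (y 0)
      rw [htime]
    have h2 : T Γ y + b - c' ((T Γ y + b) 0) = y - c (y 0) := by
      show T Γ y + b - (c (γ * ((T Γ y + b) 0) + (t₀ - γ * t₀)) -
        ((γ - 1) * ((T Γ y + b) 0 - t₀)) • E4.basisVector 0) = y - c (y 0)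
      rw [htime, hAΓ0, hb, hTapply, hTapply, hx0]
      have e1 : (γ - 1) * (Γ * y 0 + (t₀ - Γ * t₀) - t₀) = (γ * Γ - Γ) * (y 0 - t₀) := by ring
      rw [e1, hγΓ]
      ext i
      simp only [PiLp.sub_apply, PiLp.add_apply, PiLp.smul_apply, smul_eq_mul]
      ring
    rw [h1, h2]
  have hsplit : (F' ∘ fun y ↦ T Γ y + b) = (fun z ↦ F' (z + b)) ∘ AΓ := by
    funext y; rfl
  have hxfix : T Γ x + b = x := by rw [hb]; abel
  have hD : iteratedFDeriv ℝ m F x =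
      (iteratedFDeriv ℝ m F' x).compContinuousLinearMap fun _ ↦ (AΓ : E4 →L[ℝ] E4) := by
    rw [hcomp, hsplit]
    have h1 := AΓ.iteratedFDerivWithin_comp_right (fun z ↦ F' (z + b))
      uniqueDiffOn_univ (mem_univ _) m (x := x)
    simp only [preimage_univ, iteratedFDerivWithin_univ] at h1
    rw [h1, iteratedFDeriv_comp_add_right, hAΓapply, hxfix]
  rw [hD]
  calc ‖(iteratedFDeriv ℝ m F' x).compContinuousLinearMap fun _ ↦ (AΓ : E4 →L[ℝ] E4)‖
      ≤ ‖iteratedFDeriv ℝ m F' x‖ * ∏ _i : Fin m, ‖(AΓ : E4 →L[ℝ] E4)‖ :=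
        ContinuousMultilinearMap.norm_compContinuousLinearMap_le _ _
    _ ≤ (|M| * C / d) * ∏ _i : Fin m, Γ := by
        have hnorm : ‖(AΓ : E4 →L[ℝ] E4)‖ ≤ Γ := by
          rw [hAΓcoe]; exact norm_timeScale_le_self (hTapply Γ) hΓ
        have hd0 : 0 ≤ |M| * C / d := by
          have : 0 < d := by
            have := le_max_left 1 (2 * |a|)
            linarith
          positivity
        exact mul_le_mul key (Finset.prod_le_prod (fun _ _ ↦ norm_nonneg _) fun _ _ ↦ hnorm)
          (Finset.prod_nonneg fun _ _ ↦ norm_nonneg _) hd0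
    _ = Γ ^ m * (|M| * C / d) := by
        rw [Finset.prod_const, Finset.card_univ, Fintype.card_fin, mul_comm]

-- operator-norm instance paths on form-valued multilinear maps are slow to unify
set_option synthInstance.maxHeartbeats 200000 in
/-- **Registered sub-goal form** (worker carrier `slaving_painted_summand_jet_degree_law` of the crux
item) of `exists_norm_iteratedFDeriv_ksPert_frame_le_pow`: each lab-time derivative of a painted
Kerr–Schild summand costs exactly one power of the jet scale `Γ`. [folklore] -/
theorem slaving_painted_summand_jet_degree_law : open Literature.Geometry.Lorentzian in ∀ (m : ℕ) {Γ₀ : ℝ}, 1 ≤ Γ₀ → ∃ C : ℝ, 0 ≤ C ∧ ∀ (M a : ℝ) (Θ : ℝ → E4 →L[ℝ] E4) (c : ℝ → E4) (x : E4) (d Γ : ℝ), 1 ≤ Γ → ContDiff ℝ m Θ → ContDiff ℝ m c → (∀ k ≤ m, ‖iteratedDeriv k Θ (x 0)‖ ≤ Γ₀ * Γ ^ k) → (∀ k, 1 ≤ k → k ≤ m → ‖iteratedDeriv k c (x 0)‖ ≤ Γ₀ * Γ ^ k) → max 1 (2 * |a|) ≤ d → ‖x - c (x 0)‖ ≤ d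 → d ≤ E4.spatialNorm (Θ (x 0) (x - c (x 0))) → ‖iteratedFDeriv ℝ m (fun y ↦ (Kerr.bilin M a (Θ (y 0) (y - c (y 0))) - Minkowski.bilin).bilinearComp (Θ (y 0)) (Θ (y 0))) x‖ ≤ Γ ^ m * (|M| * C / d) :=
  fun m _ hΓ₀ ↦ exists_norm_iteratedFDeriv_ksPert_frame_le_pow m hΓ₀

end Summit.FinalStateConjecture.FinalStateConjecture.Theorems.SublinearIsFree.Slaving

end
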